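import Summits.ResolutionOfSingularities.ResolutionOfSingularities.Theorems.SubmaximalShadowClasses
import Literature.AlgebraicGeometry.Resolution.QuasiRegularSequences
import Literature.AlgebraicGeometry.Resolution.NodalBlowupChartAlgebra
import HarnessLib

/-!
# Submaximal shadow cut — ALGEBRA (lens-4 g46, node «SubmaximalCut», slice S2)

Ring-level lemmas for LAW E (`noTower_submaximalSurfaceHugging`, slice S4), about the LEVEL SHADOW
`levelShadow 𝔭 I ℓ = sInf {𝔞 | 𝔭 ≤ 𝔞 ∧ I ≤ 𝔞 * 𝔭 ^ ℓ}` of an ideal `I ⊆ 𝔭 ^ ℓ` along `𝔭 = (u)`, `u` quasi-regular: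

* §1 (Q) COEFFICIENT CRITERION: for `𝔞 ⊇ 𝔭` and a form `F` of degree `ℓ`, `F(u) ∈ 𝔞·𝔭^ℓ` forces every coefficient of
  `F` into `𝔞`; hence the shadow is ATTAINED (`I ⊆ 𝔍·𝔭^ℓ`) and contains the coefficients of every degree-`ℓ`
  representation of every member of `I`.
* §2 (L1)/(P1): in a regular local ring with `u` part of a regular system of parameters, `𝔪^(ℓ+1) ⊓ 𝔭^ℓ ⊆ 𝔪·𝔭^ℓ`, so
  `I ⊆ 𝔪^(ℓ+1)` puts the shadow inside `𝔪`; the binomial estimate `(𝔞 ⊔ 𝔟)^λ ⊆ 𝔞^λ ⊔ 𝔟`; primes and powers of `𝔪`.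
(The transport of the shadow along a blow-up step is slice S3 `SubmaximalShadowCharts`.)

Pure commutative algebra; sorry-free. Sources: Matsumura1987 §16 (quasi-regular sequences), Thm. 14.2.
-/

set_option linter.dupNamespace false

open IsLocalRing MvPolynomial Literature.AlgebraicGeometry.Resolution

universe u

namespace Summit.ResolutionOfSingularities.ResolutionOfSingularities.Theorems.HugValuationCut

/-! ## §1 The coefficient criterion and attainment of the shadow -/

section Coefficients

variable {R : Type u} [CommRing R] {c : ℕ} {u : Fin c → R}

/-- **(Q) COEFFICIENT CRITERION** (quasi-regularity): if `𝔞 ⊇ (u)` and `F` is a form of degree `ℓ` with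
`F(u) ∈ 𝔞·(u)^ℓ`, then every coefficient of `F` lies in `𝔞`. [cite: Matsumura1987, §16 Definition p. 124, Thm. 16.2] -/
theorem coeff_mem_of_eval_mem_mul_pow (hu : IsQuasiRegular u) {𝔞 : Ideal R}
    (h𝔞 : Ideal.span (Set.range u) ≤ 𝔞) {ℓ : ℕ} {F : MvPolynomial (Fin c) R} (hF : F.IsHomogeneous ℓ)
    (h : eval u F ∈ 𝔞 * Ideal.span (Set.range u) ^ ℓ) : ∀ d, F.coeff d ∈ 𝔞 := by
  obtain ⟨G, hG, hG𝔞, hGF⟩ := exists_isHomogeneous_of_mem_mul_span_pow u 𝔞 ℓ h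
  rw [mem_map_C_iff] at hG𝔞
  have h0 : eval u (F - G) ∈ Ideal.span (Set.range u) ^ (ℓ + 1) := by
    rw [map_sub, hGF, sub_self]
    exact zero_mem _
  have hq := (isQuasiRegular_def u).mp hu ℓ (F - G) (hF.sub hG) h0
  intro d
  have h1 : (F - G).coeff d + G.coeff d = F.coeff d := by rw [coeff_sub, sub_add_cancel]
  rw [← h1]
  exact add_mem (h𝔞 (hq d)) (hG𝔞 d)

/-- **the shadow is ATTAINED**: `I ⊆ 𝔍·(u)^ℓ` for `𝔍 = levelShadow (u) I ℓ`, whenever `I ⊆ (u)^ℓ` and `u` is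
quasi-regular. [cite: Matsumura1987, §16 Thm. 16.2] -/
theorem le_levelShadow_mul_pow (hu : IsQuasiRegular u) {I : Ideal R} {ℓ : ℕ}
    (hI : I ≤ Ideal.span (Set.range u) ^ ℓ) :
    I ≤ levelShadow (Ideal.span (Set.range u)) I ℓ * Ideal.span (Set.range u) ^ ℓ := by
  intro f hf
  obtain ⟨F, hF, hFf⟩ := exists_isHomogeneous_of_mem_span_pow u ℓ (hI hf)
  have hcoeff : ∀ d, F.coeff d ∈ levelShadow (Ideal.span (Set.range u)) I ℓ := by
    intro d
    refine Submodule.mem_sInf.mpr ?_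
    rintro 𝔞 ⟨h𝔭𝔞, hI𝔞⟩
    exact coeff_mem_of_eval_mem_mul_pow hu h𝔭𝔞 hF (hFf ▸ hI𝔞 hf) d
  rw [← hFf]
  exact eval_mem_mul_span_pow u hF (mem_map_C_iff.mpr hcoeff)

/-- the shadow QUALIFIES: `(u) ⊆ 𝔍` and `I ⊆ 𝔍·(u)^ℓ`. [cite: Matsumura1987, §16 Thm. 16.2] -/
theorem levelShadow_mem (hu : IsQuasiRegular u) {I : Ideal R} {ℓ : ℕ} (hI : I ≤ Ideal.span (Set.range u) ^ ℓ) :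
    Ideal.span (Set.range u) ≤ levelShadow (Ideal.span (Set.range u)) I ℓ ∧
      I ≤ levelShadow (Ideal.span (Set.range u)) I ℓ * Ideal.span (Set.range u) ^ ℓ :=
  ⟨le_levelShadow _ _ _, le_levelShadow_mul_pow hu hI⟩

/-- **coefficients of representations lie in the shadow**: if `F` is a form of degree `ℓ` with `F(u) ∈ I`, then every
coefficient of `F` lies in `levelShadow (u) I ℓ`. [cite: Matsumura1987, §16 Thm. 16.2] -/
theorem coeff_mem_levelShadow (hu : IsQuasiRegular u) {I : Ideal R} {ℓ : ℕ}
    (hI : I ≤ Ideal.span (Set.range u) ^ ℓ) {F : MvPolynomial (Fin c) R} (hF : F.IsHomogeneous ℓ)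
    (hf : eval u F ∈ I) : ∀ d, F.coeff d ∈ levelShadow (Ideal.span (Set.range u)) I ℓ :=
  coeff_mem_of_eval_mem_mul_pow hu (le_levelShadow _ _ _) hF (le_levelShadow_mul_pow hu hI hf)

/-- the shadow of an ideal in a LARGER ideal `𝔞·(u)^ℓ`, `𝔞 ⊇ (u)`, lies below `𝔞` (restating `levelShadow_le`). [folklore] -/
theorem levelShadow_le_of_le_mul_pow {I 𝔞 : Ideal R} {ℓ : ℕ} (h𝔞 : Ideal.span (Set.range u) ≤ 𝔞)
    (hI : I ≤ 𝔞 * Ideal.span (Set.range u) ^ ℓ) : levelShadow (Ideal.span (Set.range u)) I ℓ ≤ 𝔞 :=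
  levelShadow_le h𝔞 hI

end Coefficients

/-! ## §2 Regular local rings: the shadow is a proper ideal; binomial estimate; primary-to-`𝔪` -/

section RegularLocal

variable {R : Type u} [CommRing R]

-- WRITER NOTE (g16): PIN d540acd7 carried `theorem range_fin_append` here; it restates the landed
-- `Literature.AlgebraicGeometry.Resolution.range_fin_append` (AlterationsEnlargingZ, already in the import closure) and was
-- deleted at the gate's `dedup.landed` bounce p839052; the one use (SubmaximalShadowCharts, `rw [range_fin_append, …]`) resolves
-- to the Literature declaration through `open Literature.AlgebraicGeometry.Resolution`. Nothing else changed.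

/-- **(L1)**: for `u` part of a regular system of parameters of a regular local ring and `𝔭 = (u)`,
`𝔪^(ℓ+1) ⊓ 𝔭^ℓ ⊆ 𝔪·𝔭^ℓ` (a form of degree `ℓ` in `u` lying in `𝔪^(ℓ+1)` has all its coefficients in `𝔪`, by
quasi-regularity of a full regular system of parameters extending `u`). [cite: Matsumura1987, Thm. 14.2, Thm. 16.2] -/
theorem pow_succ_inf_pow_le_mul_pow [IsLocalRing R] {c : ℕ} {u : Fin c → R} (hu : IsRsopPart u) (ℓ : ℕ) :
    maximalIdeal R ^ (ℓ + 1) ⊓ Ideal.span (Set.range u) ^ ℓ ≤ maximalIdeal R * Ideal.span (Set.range u) ^ ℓ := by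
  haveI := hu.isRegularLocalRing
  obtain ⟨e, x, hd, hx, hxu⟩ := hu.exists_rsop
  have hxq : IsQuasiRegular x := isQuasiRegular_rsop_comp hd x hx id Function.injective_id
  rintro f ⟨hfm, hfp⟩
  obtain ⟨F, hF, hFf⟩ := exists_isHomogeneous_of_mem_span_pow u ℓ hfp
  -- read `F` in all the variables `x ⊇ u`
  have hux : u = x ∘ Fin.castAdd e := funext fun i => (hxu i).symm
  have hren : eval x (rename (Fin.castAdd e) F) = f := by rw [eval_rename, ← hux, hFf]
  have hmem : eval x (rename (Fin.castAdd e) F) ∈ Ideal.span (Set.range x) ^ (ℓ + 1) := by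
    rw [hren, hx]; exact hfm
  have hq := (isQuasiRegular_def x).mp hxq ℓ _ hF.rename_isHomogeneous hmem
  have hcoeff : ∀ d, F.coeff d ∈ maximalIdeal R := by
    intro d
    have h1 := hq (Finsupp.mapDomain (Fin.castAdd e) d)
    rwa [coeff_rename_mapDomain _ (Fin.castAdd_injective c e), hx] at h1
  rw [← hFf]
  exact eval_mem_mul_span_pow u hF (mem_map_C_iff.mpr hcoeff)

/-- **(P1) the shadow is PROPER**: `I ⊆ 𝔪^(ℓ+1)` and `I ⊆ 𝔭^ℓ` give `levelShadow 𝔭 I ℓ ⊆ 𝔪`. [cite: Matsumura1987, Thm. 16.2] -/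
theorem levelShadow_le_maximalIdeal [IsLocalRing R] {c : ℕ} {u : Fin c → R} (hu : IsRsopPart u) {I : Ideal R}
    {ℓ : ℕ} (hIm : I ≤ maximalIdeal R ^ (ℓ + 1)) (hI : I ≤ Ideal.span (Set.range u) ^ ℓ) :
    levelShadow (Ideal.span (Set.range u)) I ℓ ≤ maximalIdeal R :=
  levelShadow_le hu.span_range_le_maximalIdeal
    (le_trans (le_inf hIm hI) (pow_succ_inf_pow_le_mul_pow hu ℓ))

/-- **binomial estimate** `(𝔞 ⊔ 𝔟)^λ ⊆ 𝔞^λ ⊔ 𝔟`. [folklore] -/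
theorem sup_pow_le_pow_sup (𝔞 𝔟 : Ideal R) (la : ℕ) : (𝔞 ⊔ 𝔟) ^ la ≤ 𝔞 ^ la ⊔ 𝔟 := by
  induction la with
  | zero => simp
  | succ n ih =>
    calc (𝔞 ⊔ 𝔟) ^ (n + 1) = (𝔞 ⊔ 𝔟) * (𝔞 ⊔ 𝔟) ^ n := pow_succ' _ _
      _ ≤ (𝔞 ⊔ 𝔟) * (𝔞 ^ n ⊔ 𝔟) := Ideal.mul_mono_right ih
      _ = 𝔞 * 𝔞 ^ n ⊔ 𝔞 * 𝔟 ⊔ (𝔟 * 𝔞 ^ n ⊔ 𝔟 * 𝔟) := by rw [Ideal.sup_mul, Ideal.mul_sup, Ideal.mul_sup]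
      _ ≤ 𝔞 ^ (n + 1) ⊔ 𝔟 := by
        refine sup_le (sup_le ?_ ?_) (sup_le ?_ ?_)
        · rw [← pow_succ']
          exact le_sup_left
        · exact le_sup_of_le_right Ideal.mul_le_left
        · exact le_sup_of_le_right Ideal.mul_le_right
        · exact le_sup_of_le_right Ideal.mul_le_right

/-- **an ideal of a Noetherian local ring contained in no prime other than `𝔪` contains a power of `𝔪`.**
[cite: AtiyahMacdonald1969, Prop. 7.14, Cor. 7.16] -/
theorem exists_maximalIdeal_pow_le [IsLocalRing R] [IsNoetherianRing R] {J : Ideal R}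
    (h : ∀ 𝔔 : Ideal R, 𝔔.IsPrime → J ≤ 𝔔 → 𝔔 = maximalIdeal R) : ∃ n : ℕ, maximalIdeal R ^ n ≤ J := by
  have hrad : maximalIdeal R ≤ J.radical := by
    rw [Ideal.radical_eq_sInf]
    refine le_sInf ?_
    rintro 𝔔 ⟨hJ𝔔, h𝔔⟩
    exact (h 𝔔 h𝔔 hJ𝔔).ge
  exact Ideal.exists_pow_le_of_le_radical_of_fg hrad (IsNoetherian.noetherian _)

/-- a part of a regular system of parameters of FULL length generates `𝔪`. [cite: Matsumura1987, Thm. 14.2] -/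
theorem IsRsopPart.span_range_eq_maximalIdeal [IsLocalRing R] {n : ℕ} {z : Fin n → R} (hz : IsRsopPart z)
    (hd : ringKrullDim R = (n : ℕ)) : Ideal.span (Set.range z) = maximalIdeal R := by
  obtain ⟨-, e, y, hdim, hspan⟩ := hz
  rw [hd] at hdim
  have he : e = 0 := by
    have : (n : ℕ) = n + e := by exact_mod_cast (WithBot.coe_eq_coe.mp hdim : ((n : ℕ) : ℕ∞) = (n + e : ℕ))
    omega
  subst he
  rw [← hspan]
  congr 1
  rw [Set.range_eq_empty y, Set.union_empty]

/-- the initial segment of a `Fin.snoc` family is the original family. [folklore] -/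
theorem image_snoc_Iio_last {α : Type*} {c : ℕ} (u' : Fin c → α) (g : α) :
    (Fin.snoc u' g : Fin (c + 1) → α) '' Set.Iio (Fin.last c) = Set.range u' := by
  ext x
  constructor
  · rintro ⟨i, hi, rfl⟩
    have hne : i ≠ Fin.last c := ne_of_lt hi
    obtain ⟨t, rfl⟩ := Fin.exists_castSucc_eq.mpr hne
    exact ⟨t, by simp⟩
  · rintro ⟨t, rfl⟩
    exact ⟨Fin.castSucc t, Fin.castSucc_lt_last t, by simp⟩

/-- **the last member of a regular-parameter family is a nonzerodivisor modulo the others**: if `(u', g)` (as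
`Fin.snoc u' g`) is part of a regular system of parameters, then `g·y ∈ (u')` forces `y ∈ (u')`.
[cite: Matsumura1987, Thm. 14.2, Thm. 16.2] -/
theorem mem_span_of_snoc_isRsopPart [IsLocalRing R] {c : ℕ} {g : R} {u' : Fin c → R}
    (h : IsRsopPart (Fin.snoc u' g : Fin (c + 1) → R)) {y : R} (hy : g * y ∈ Ideal.span (Set.range u')) :
    y ∈ Ideal.span (Set.range u') := by
  have h1 := h.mem_span_Iio_of_mul_mem (Fin.last c) y (by rwa [image_snoc_Iio_last, Fin.snoc_last])
  rwa [image_snoc_Iio_last] at h1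

/-- iterating `mem_span_of_snoc_isRsopPart`: `g^N·y ∈ (u')` forces `y ∈ (u')`. [cite: Matsumura1987, Thm. 14.2, Thm. 16.2] -/
theorem mem_span_of_pow_mul_mem [IsLocalRing R] {c : ℕ} {g : R} {u' : Fin c → R}
    (h : IsRsopPart (Fin.snoc u' g : Fin (c + 1) → R)) {y : R} :
    ∀ {N : ℕ}, g ^ N * y ∈ Ideal.span (Set.range u') → y ∈ Ideal.span (Set.range u')
  | 0, hy => by simpa using hy
  | N + 1, hy => by
    rw [pow_succ', mul_assoc] at hy
    exact mem_span_of_pow_mul_mem h (mem_span_of_snoc_isRsopPart h hy)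

/-- the ideal of a `Fin.snoc` family. [folklore] -/
theorem span_range_snoc {c : ℕ} (u : Fin c → R) (a : R) :
    Ideal.span (Set.range (Fin.snoc u a : Fin (c + 1) → R)) = Ideal.span (Set.range u) ⊔ Ideal.span {a} := by
  refine le_antisymm ?_ (sup_le ?_ ?_)
  · rw [Ideal.span_le]
    rintro _ ⟨i, rfl⟩
    refine Fin.lastCases ?_ (fun t => ?_) i
    · rw [Fin.snoc_last]
      exact Ideal.mem_sup_right (Ideal.mem_span_singleton_self a)
    · rw [Fin.snoc_castSucc]
      exact Ideal.mem_sup_left (Ideal.subset_span (Set.mem_range_self t))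
  · rw [Ideal.span_le]
    rintro _ ⟨t, rfl⟩
    exact Ideal.subset_span ⟨Fin.castSucc t, by simp⟩
  · rw [Ideal.span_le, Set.singleton_subset_iff]
    exact Ideal.subset_span ⟨Fin.last c, by simp⟩

/-- the ideal of a `Fin.cons` family. [folklore] -/
theorem span_range_cons {c : ℕ} (a : R) (u : Fin c → R) :
    Ideal.span (Set.range (Fin.cons a u : Fin (c + 1) → R)) = Ideal.span {a} ⊔ Ideal.span (Set.range u) := by
  rw [Fin.range_cons, Ideal.span_insert]

/-- cancellation in `WithBot ℕ∞`: `x + a = b + a` (naturals `a`, `b`) forces `x = b`. [folklore] -/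
theorem withBot_eNat_add_natCast_cancel {x : WithBot ℕ∞} {a b : ℕ} (h : x + (a : WithBot ℕ∞) = ((b + a : ℕ) : WithBot ℕ∞)) :
    x = (b : WithBot ℕ∞) := by
  induction x using WithBot.recBotCoe with
  | bot =>
    rw [WithBot.bot_add, ← WithBot.coe_natCast] at h
    exact absurd h WithBot.bot_ne_coe
  | coe y =>
    induction y using ENat.recTopCoe with
    | top =>
      rw [← WithBot.coe_natCast, ← WithBot.coe_natCast, ← WithBot.coe_add, WithBot.coe_inj, top_add] at h
      exact absurd h (ENat.top_ne_coe _)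
    | coe z =>
      have h' : z + a = b + a := by exact_mod_cast h
      have hz : z = b := by omega
      subst hz
      rfl

/-- **ADAPTED REGULAR PARAMETERS**: for `u` part of a regular system of parameters of a regular local ring of
dimension `c + 2` and `a₀ ∈ 𝔪 ∖ (𝔪² + (u))`, there is a regular system of parameters `z = (u, a₀, b)`.
[cite: Matsumura1987, Thm. 14.2] -/
theorem exists_rsop_adapted [IsRegularLocalRing R] {c : ℕ} {u : Fin c → R} (hu : IsRsopPart u)
    (hdim : ringKrullDim R = (c + 2 : ℕ)) {a₀ : R} (ha₀ : a₀ ∈ maximalIdeal R)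
    (hnd : a₀ ∉ maximalIdeal R ^ 2 ⊔ Ideal.span (Set.range u)) :
    ∃ z : Fin (c + 1 + 1) → R, Ideal.span (Set.range z) = maximalIdeal R ∧
      (maximalIdeal R).spanFinrank = c + 1 + 1 ∧ (∀ t, z (Fin.castSucc (Fin.castSucc t)) = u t) ∧
      z (Fin.castSucc (Fin.last c)) = a₀ := by
  -- (1) `a₀` is a regular parameter of `A = R/(u)`
  haveI hA : IsRegularLocalRing (R ⧸ Ideal.span (Set.range u)) := hu.isRegularLocalRing_quotient
  have hmA : maximalIdeal (R ⧸ Ideal.span (Set.range u)) =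
      (maximalIdeal R).map (Ideal.Quotient.mk (Ideal.span (Set.range u))) :=
    (map_maximalIdeal_of_surjective _ Ideal.Quotient.mk_surjective).symm
  have hā : Ideal.Quotient.mk (Ideal.span (Set.range u)) a₀ ∈ maximalIdeal (R ⧸ Ideal.span (Set.range u)) := by
    rw [hmA]; exact Ideal.mem_map_of_mem _ ha₀
  have hā2 : Ideal.Quotient.mk (Ideal.span (Set.range u)) a₀ ∉ maximalIdeal (R ⧸ Ideal.span (Set.range u)) ^ 2 := by
    rw [hmA, ← Ideal.map_pow]
    intro h
    apply hnd
    have h' : a₀ ∈ ((maximalIdeal R ^ 2).map (Ideal.Quotient.mk (Ideal.span (Set.range u)))).comap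
        (Ideal.Quotient.mk (Ideal.span (Set.range u))) := h
    rwa [Ideal.comap_map_of_surjective _ Ideal.Quotient.mk_surjective, ← RingHom.ker_eq_comap_bot,
      Ideal.mk_ker] at h'
  obtain ⟨hq1, hdim1⟩ := IsRegularLocalRing.quotient_span_singleton hā hā2
  -- (2) hence `(u, a₀)` is a part of a regular system of parameters of `R`
  have hsup := span_range_snoc u a₀
  let e : (R ⧸ Ideal.span (Set.range (Fin.snoc u a₀ : Fin (c + 1) → R))) ≃+*
      (R ⧸ Ideal.span (Set.range u)) ⧸ Ideal.span {Ideal.Quotient.mk (Ideal.span (Set.range u)) a₀} :=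
    (Ideal.quotEquivOfEq hsup).trans
      ((DoubleQuot.quotQuotEquivQuotSup (Ideal.span (Set.range u)) (Ideal.span {a₀})).symm.trans
        (Ideal.quotEquivOfEq (by rw [Ideal.map_span, Set.image_singleton])))
  haveI : IsRegularLocalRing (R ⧸ Ideal.span (Set.range (Fin.snoc u a₀ : Fin (c + 1) → R))) :=
    IsRegularLocalRing.of_ringEquiv e.symm
  have hdim' : ringKrullDim (R ⧸ Ideal.span (Set.range (Fin.snoc u a₀ : Fin (c + 1) → R))) + (c + 1 : ℕ) ≤
      ringKrullDim R := by
    rw [ringKrullDim_eq_of_ringEquiv e, Nat.cast_succ, add_comm (c : WithBot ℕ∞) 1, ← add_assoc, hdim1,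
      hu.ringKrullDim_quotient_add]
  have hzm : ∀ i, (Fin.snoc u a₀ : Fin (c + 1) → R) i ∈ maximalIdeal R := fun i => by
    refine Fin.lastCases ?_ (fun t => ?_) i
    · rwa [Fin.snoc_last]
    · rw [Fin.snoc_castSucc]; exact hu.mem_maximalIdeal t
  have hsnoc : IsRsopPart (Fin.snoc u a₀ : Fin (c + 1) → R) :=
    IsRsopPart.of_isRegularLocalRing_quotient hzm hdim'
  -- (3) extend to a regular system of parameters: exactly one more member
  obtain ⟨e', x, hrank, hxspan, hxz⟩ := hsnoc.exists_rsop
  have he' : e' = 1 := by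
    have h := IsRegularLocalRing.spanFinrank_maximalIdeal (R := R)
    rw [hrank, hdim] at h
    have : c + 1 + e' = c + 2 := by exact_mod_cast h
    omega
  subst he'
  refine ⟨x, hxspan, hrank, fun t => ?_, ?_⟩
  · have h1 := hxz (Fin.castSucc t)
    rw [Fin.snoc_castSucc] at h1
    exact h1
  · have h1 := hxz (Fin.last c)
    rw [Fin.snoc_last] at h1
    exact h1

end RegularLocal

end Summit.ResolutionOfSingularities.ResolutionOfSingularities.Theorems.HugValuationCut
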